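import Mathlib.Probability.Moments.Covariance
import Literature.Probability.Moments.DecorrelationExtension
import HarnessLib

/-!
# Extending a decorrelation bound from indicators to bounded functions, II: covariance forms

Topic `Literature/Probability/Moments` (kind proof; no new notions; sequel of
`DecorrelationExtension.lean`).  On a probability space, the indicator decorrelation bound
`|E[H 𝟙_T(U) · H' 𝟙_{T'}(U')] − E[H 𝟙_T(U)] E[H' 𝟙_{T'}(U')]| ≤ ζ ν(T) ν(T')` (all measurable
`T, T'`; `|H|, |H'| ≤ 1`) gives

* `abs_covariance_le_of_indicator` — `|Cov(H f(U), H' f'(U'))| ≤ ζ B B' ν(D) ν(D')` for measurable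
  `0 ≤ f ≤ B`, `0 ≤ f' ≤ B'` supported in `D`, `D'` (`covariance_eq_sub` and the integral form);
* `abs_covariance_le_of_indicator_of_abs_le` — `≤ 4 ζ B B' ν(D) ν(D')` for SIGNED `|f| ≤ B`,
  `|f'| ≤ B'` (split into positive and negative parts, bilinearity `covariance_fun_sub_fun_sub`);
* `abs_covariance_le_of_abs_le_indicator` — the complementary CRUDE bound from the supports alone:
  `|Cov(X, Y)| ≤ B B' (P(E ∩ E') + P(E) P(E'))` when `|X| ≤ B 𝟙_E`, `|Y| ≤ B' 𝟙_{E'}`.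

This is the bounded case of the covariance inequality for event-defined mixing coefficients
(Doukhan 1994 §1.2.2).

## References

* P. Doukhan, *Mixing: Properties and Examples*, LNS 85, Springer 1994, §1.2.2.  [folklore]
-/

noncomputable section

open MeasureTheory ProbabilityTheory

namespace Literature.Probability.Moments

/-! ## Covariance forms -/

section Covariance

variable {Ω α : Type*} [MeasurableSpace Ω] [MeasurableSpace α]
  {P : Measure Ω} [IsProbabilityMeasure P] {ν : Measure α} [IsFiniteMeasure ν]

/-- Bounded measurable real functions are in `L²` of a finite measure. [folklore] -/
theorem memLp_two_of_abs_le' {g : Ω → ℝ} (hg : Measurable g) {C : ℝ} (hC : ∀ ω, |g ω| ≤ C) :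
    MemLp g 2 P :=
  memLp_of_bounded (a := -C) (b := C) (ae_of_all _ fun ω => abs_le.1 (hC ω)) hg.aestronglyMeasurable 2

/-- **Covariance form, nonnegative functions** (probability measure): under the indicator
decorrelation bound, `|Cov(H f(U), H' f'(U'))| ≤ ζ B B' ν(D) ν(D')` for measurable `0 ≤ f ≤ B`,
`0 ≤ f' ≤ B'` supported in `D`, `D'`. [folklore] -/
theorem abs_covariance_le_of_indicator {U U' : Ω → α} (hU : Measurable U)
    (hU' : Measurable U') {H H' : Ω → ℝ} (hH : Measurable H) (hH' : Measurable H')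
    (hH1 : ∀ ω, |H ω| ≤ 1) (hH'1 : ∀ ω, |H' ω| ≤ 1) {ζ : ℝ} (hζ : 0 ≤ ζ)
    (hdec : ∀ T T' : Set α, MeasurableSet T → MeasurableSet T' →
      |(∫ ω, H ω * T.indicator (fun _ => (1 : ℝ)) (U ω) * (H' ω * T'.indicator (fun _ => (1 : ℝ)) (U' ω)) ∂P) -
          (∫ ω, H ω * T.indicator (fun _ => (1 : ℝ)) (U ω) ∂P) *
            (∫ ω, H' ω * T'.indicator (fun _ => (1 : ℝ)) (U' ω) ∂P)| ≤ ζ * ν.real T * ν.real T')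
    {f f' : α → ℝ} (hf : Measurable f) (hf' : Measurable f') {B B' : ℝ} (hB : 0 < B) (hB' : 0 < B')
    (hf0 : ∀ a, 0 ≤ f a) (hfB : ∀ a, f a ≤ B) (hf'0 : ∀ a, 0 ≤ f' a) (hf'B : ∀ a, f' a ≤ B')
    {D D' : Set α} (hfD : ∀ a, f a ≠ 0 → a ∈ D) (hf'D : ∀ a, f' a ≠ 0 → a ∈ D') :
    |cov[fun ω => H ω * f (U ω), fun ω => H' ω * f' (U' ω); P]| ≤
      ζ * B * B' * ν.real D * ν.real D' := by
  have hX2 : MemLp (fun ω => H ω * f (U ω)) 2 P :=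
    memLp_two_of_abs_le' (hH.mul (hf.comp hU)) (C := B) fun ω => by
      rw [abs_mul, abs_of_nonneg (hf0 _)]
      exact (mul_le_mul (hH1 ω) (hfB _) (hf0 _) zero_le_one).trans_eq (one_mul B)
  have hY2 : MemLp (fun ω => H' ω * f' (U' ω)) 2 P :=
    memLp_two_of_abs_le' (hH'.mul (hf'.comp hU')) (C := B') fun ω => by
      rw [abs_mul, abs_of_nonneg (hf'0 _)]
      exact (mul_le_mul (hH'1 ω) (hf'B _) (hf'0 _) zero_le_one).trans_eq (one_mul B')
  rw [covariance_eq_sub hX2 hY2]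
  exact abs_integral_mul_sub_le_of_indicator hU hU' hH hH' hH1 hH'1 hζ hdec hf hf' hB hB' hf0 hfB
    hf'0 hf'B hfD hf'D

/-- **Covariance form, signed functions**: under the indicator decorrelation bound,
`|Cov(H f(U), H' f'(U'))| ≤ 4 ζ B B' ν(D) ν(D')` for measurable `|f| ≤ B`, `|f'| ≤ B'` supported in
`D`, `D'` (split `f = f⁺ − f⁻`, `f' = f'⁺ − f'⁻` and use bilinearity of the covariance). [folklore] -/
theorem abs_covariance_le_of_indicator_of_abs_le {U U' : Ω → α} (hU : Measurable U)
    (hU' : Measurable U') {H H' : Ω → ℝ} (hH : Measurable H) (hH' : Measurable H')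
    (hH1 : ∀ ω, |H ω| ≤ 1) (hH'1 : ∀ ω, |H' ω| ≤ 1) {ζ : ℝ} (hζ : 0 ≤ ζ)
    (hdec : ∀ T T' : Set α, MeasurableSet T → MeasurableSet T' →
      |(∫ ω, H ω * T.indicator (fun _ => (1 : ℝ)) (U ω) * (H' ω * T'.indicator (fun _ => (1 : ℝ)) (U' ω)) ∂P) -
          (∫ ω, H ω * T.indicator (fun _ => (1 : ℝ)) (U ω) ∂P) *
            (∫ ω, H' ω * T'.indicator (fun _ => (1 : ℝ)) (U' ω) ∂P)| ≤ ζ * ν.real T * ν.real T')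
    {f f' : α → ℝ} (hf : Measurable f) (hf' : Measurable f') {B B' : ℝ} (hB : 0 < B) (hB' : 0 < B')
    (hfB : ∀ a, |f a| ≤ B) (hf'B : ∀ a, |f' a| ≤ B')
    {D D' : Set α} (hfD : ∀ a, f a ≠ 0 → a ∈ D) (hf'D : ∀ a, f' a ≠ 0 → a ∈ D') :
    |cov[fun ω => H ω * f (U ω), fun ω => H' ω * f' (U' ω); P]| ≤
      4 * (ζ * B * B' * ν.real D * ν.real D') := by
  -- positive and negative parts
  set fp : α → ℝ := fun a => max (f a) 0 with hfp
  set fm : α → ℝ := fun a => max (-f a) 0 with hfm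
  set gp : α → ℝ := fun a => max (f' a) 0 with hgp
  set gm : α → ℝ := fun a => max (-f' a) 0 with hgm
  have hpm : ∀ (φ : α → ℝ) (C : ℝ) (E : Set α), Measurable φ → (∀ a, |φ a| ≤ C) →
      (∀ a, φ a ≠ 0 → a ∈ E) →
      (Measurable fun a => max (φ a) 0) ∧ (∀ a, 0 ≤ max (φ a) 0) ∧ (∀ a, max (φ a) 0 ≤ C) ∧
        (∀ a, max (φ a) 0 ≠ 0 → a ∈ E) := by
    intro φ C E hφ hφC hφE
    refine ⟨hφ.max measurable_const, fun a => le_max_right _ _,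
      fun a => max_le ((le_abs_self _).trans (hφC a)) ((abs_nonneg _).trans (hφC a)), fun a ha => hφE a ?_⟩
    intro h0; exact ha (by rw [h0, max_self])
  obtain ⟨hfpm, hfp0, hfpB, hfpD⟩ := hpm f B D hf hfB hfD
  obtain ⟨hfmm, hfm0, hfmB, hfmD⟩ := hpm (fun a => -f a) B D hf.neg (fun a => by rw [abs_neg]; exact hfB a)
    (fun a ha => hfD a (fun h0 => ha (by rw [h0, neg_zero])))
  obtain ⟨hgpm, hgp0, hgpB, hgpD⟩ := hpm f' B' D' hf' hf'B hf'D
  obtain ⟨hgmm, hgm0, hgmB, hgmD⟩ := hpm (fun a => -f' a) B' D' hf'.neg (fun a => by rw [abs_neg]; exact hf'B a)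
    (fun a ha => hf'D a (fun h0 => ha (by rw [h0, neg_zero])))
  -- the four decorated variables
  have h2 : ∀ (K : Ω → ℝ) (V : Ω → α) (φ : α → ℝ) (C : ℝ), Measurable K → Measurable V → Measurable φ →
      (∀ ω, |K ω| ≤ 1) → (∀ a, 0 ≤ φ a) → (∀ a, φ a ≤ C) → MemLp (fun ω => K ω * φ (V ω)) 2 P := by
    intro K V φ C hK hV hφ hK1 hφ0 hφC
    exact memLp_two_of_abs_le' (hK.mul (hφ.comp hV)) (C := C) fun ω => by
      rw [abs_mul, abs_of_nonneg (hφ0 _)]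
      exact (mul_le_mul (hK1 ω) (hφC _) (hφ0 _) zero_le_one).trans_eq (one_mul C)
  have hXp := h2 H U fp B hH hU hfpm hH1 hfp0 hfpB
  have hXm := h2 H U fm B hH hU hfmm hH1 hfm0 hfmB
  have hYp := h2 H' U' gp B' hH' hU' hgpm hH'1 hgp0 hgpB
  have hYm := h2 H' U' gm B' hH' hU' hgmm hH'1 hgm0 hgmB
  have eX : (fun ω => H ω * f (U ω)) = fun ω => H ω * fp (U ω) - H ω * fm (U ω) := by
    funext ω; rw [← mul_sub, hfp, hfm]; dsimp only; rw [max_zero_sub_max_neg_zero_eq_self]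
  have eY : (fun ω => H' ω * f' (U' ω)) = fun ω => H' ω * gp (U' ω) - H' ω * gm (U' ω) := by
    funext ω; rw [← mul_sub, hgp, hgm]; dsimp only; rw [max_zero_sub_max_neg_zero_eq_self]
  rw [eX, eY, covariance_fun_sub_fun_sub hXp hXm hYp hYm]
  have b1 := abs_covariance_le_of_indicator hU hU' hH hH' hH1 hH'1 hζ hdec hfpm hgpm hB hB' hfp0 hfpB
    hgp0 hgpB hfpD hgpD
  have b2 := abs_covariance_le_of_indicator hU hU' hH hH' hH1 hH'1 hζ hdec hfpm hgmm hB hB' hfp0 hfpB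
    hgm0 hgmB hfpD hgmD
  have b3 := abs_covariance_le_of_indicator hU hU' hH hH' hH1 hH'1 hζ hdec hfmm hgpm hB hB' hfm0 hfmB
    hgp0 hgpB hfmD hgpD
  have b4 := abs_covariance_le_of_indicator hU hU' hH hH' hH1 hH'1 hζ hdec hfmm hgmm hB hB' hfm0 hfmB
    hgm0 hgmB hfmD hgmD
  rw [abs_le] at b1 b2 b3 b4 ⊢
  constructor <;> linarith [b1.1, b1.2, b2.1, b2.2, b3.1, b3.2, b4.1, b4.2]

/-- **Crude covariance bound from supports.**  If `|X| ≤ B 𝟙_E`, `|Y| ≤ B' 𝟙_{E'}` pointwise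
(`X, Y` measurable, `E, E'` measurable, probability measure), then
`|Cov(X, Y)| ≤ B B' (P(E ∩ E') + P(E) P(E'))`. [folklore] -/
theorem abs_covariance_le_of_abs_le_indicator {X Y : Ω → ℝ} (hX : Measurable X) (hY : Measurable Y)
    {E E' : Set Ω} (hE : MeasurableSet E) (hE' : MeasurableSet E') {B B' : ℝ} (hB : 0 ≤ B) (hB' : 0 ≤ B')
    (hXE : ∀ ω, |X ω| ≤ B * E.indicator (fun _ => (1 : ℝ)) ω)
    (hYE : ∀ ω, |Y ω| ≤ B' * E'.indicator (fun _ => (1 : ℝ)) ω) :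
    |cov[X, Y; P]| ≤ B * B' * (P.real (E ∩ E') + P.real E * P.real E') := by
  have hind : ∀ (S : Set Ω) (ω : Ω), 0 ≤ S.indicator (fun _ => (1 : ℝ)) ω ∧ S.indicator (fun _ => (1 : ℝ)) ω ≤ 1 :=
    fun S ω => by
      by_cases h : ω ∈ S
      · rw [Set.indicator_of_mem h]; exact ⟨zero_le_one, le_rfl⟩
      · rw [Set.indicator_of_notMem h]; exact ⟨le_rfl, zero_le_one⟩
  have hind' : ∀ (S : Set Ω) (c : ℝ) (ω : Ω), c * S.indicator (fun _ => (1 : ℝ)) ω = S.indicator (fun _ => c) ω :=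
    fun S c ω => by by_cases h : ω ∈ S <;> simp [h]
  have hXB : ∀ ω, |X ω| ≤ B := fun ω =>
    (hXE ω).trans ((mul_le_mul_of_nonneg_left (hind E ω).2 hB).trans_eq (mul_one B))
  have hYB : ∀ ω, |Y ω| ≤ B' := fun ω =>
    (hYE ω).trans ((mul_le_mul_of_nonneg_left (hind E' ω).2 hB').trans_eq (mul_one B'))
  have hX2 : MemLp X 2 P := memLp_two_of_abs_le' hX hXB
  have hY2 : MemLp Y 2 P := memLp_two_of_abs_le' hY hYB
  rw [covariance_eq_sub hX2 hY2]
  -- the three integrals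
  have h1 : |∫ ω, (X * Y) ω ∂P| ≤ B * B' * P.real (E ∩ E') := by
    refine (abs_integral_le_integral_abs (f := X * Y)).trans ?_
    have hle : ∀ ω, |(X * Y) ω| ≤ (E ∩ E').indicator (fun _ => B * B') ω := fun ω => by
      rw [Pi.mul_apply, abs_mul]
      by_cases hω : ω ∈ E ∩ E'
      · rw [Set.indicator_of_mem hω]
        exact mul_le_mul (hXB ω) (hYB ω) (abs_nonneg _) hB
      · rw [Set.indicator_of_notMem hω]
        rcases not_and_or.1 hω with h | h
        · have : |X ω| ≤ 0 := by simpa [Set.indicator_of_notMem h] using hXE ω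
          rw [le_antisymm this (abs_nonneg _), zero_mul]
        · have : |Y ω| ≤ 0 := by simpa [Set.indicator_of_notMem h] using hYE ω
          rw [le_antisymm this (abs_nonneg _), mul_zero]
    calc ∫ ω, |(X * Y) ω| ∂P ≤ ∫ ω, (E ∩ E').indicator (fun _ => B * B') ω ∂P :=
          integral_mono_of_nonneg (ae_of_all _ fun ω => abs_nonneg _)
            ((integrable_const _).indicator (hE.inter hE')) (ae_of_all _ hle)
      _ = B * B' * P.real (E ∩ E') := by
          rw [integral_indicator_const _ (hE.inter hE'), smul_eq_mul, mul_comm]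
  have h2 : |∫ ω, X ω ∂P| ≤ B * P.real E := by
    refine (abs_integral_le_integral_abs (f := X)).trans ?_
    calc ∫ ω, |X ω| ∂P ≤ ∫ ω, E.indicator (fun _ => B) ω ∂P :=
          integral_mono_of_nonneg (ae_of_all _ fun ω => abs_nonneg _)
            ((integrable_const _).indicator hE) (ae_of_all _ fun ω => (hXE ω).trans_eq (hind' E B ω))
      _ = B * P.real E := by rw [integral_indicator_const _ hE, smul_eq_mul, mul_comm]
  have h3 : |∫ ω, Y ω ∂P| ≤ B' * P.real E' := by
    refine (abs_integral_le_integral_abs (f := Y)).trans ?_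
    calc ∫ ω, |Y ω| ∂P ≤ ∫ ω, E'.indicator (fun _ => B') ω ∂P :=
          integral_mono_of_nonneg (ae_of_all _ fun ω => abs_nonneg _)
            ((integrable_const _).indicator hE') (ae_of_all _ fun ω => (hYE ω).trans_eq (hind' E' B' ω))
      _ = B' * P.real E' := by rw [integral_indicator_const _ hE', smul_eq_mul, mul_comm]
  calc |(∫ ω, (X * Y) ω ∂P) - (∫ ω, X ω ∂P) * (∫ ω, Y ω ∂P)|
      ≤ |∫ ω, (X * Y) ω ∂P| + |∫ ω, X ω ∂P| * |∫ ω, Y ω ∂P| := by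
        rw [← abs_mul]; exact abs_sub _ _
    _ ≤ B * B' * P.real (E ∩ E') + B * P.real E * (B' * P.real E') :=
        add_le_add h1 (mul_le_mul h2 h3 (abs_nonneg _) (mul_nonneg hB measureReal_nonneg))
    _ = B * B' * (P.real (E ∩ E') + P.real E * P.real E') := by ring

end Covariance

end Literature.Probability.Moments

end
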